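import Literature.NumberTheory.Automorphic.AutomorphicQuotientKernelFibreSum
import Literature.NumberTheory.Automorphic.AdelicGroupDataQuotientUnimodular
import Literature.MeasureTheory.Group.InvariantQuotientConjugacySum
import HarnessLib

/-!
# The geometric side of the trace formula on a compact automorphic quotient:
`∫_X K_Φ(x, x) dμ(x) = κ Σ_{[γ]} d_{[γ]} ∫_{G(𝔸) ⧸ G_γ} Φ_A(y γ y⁻¹) dμ_γ(y)`
(Gelbart, *Automorphic forms on adele groups* (1975), (9.12)–(9.13), Remark 9.23, (10.14))

Topic `NumberTheory/Automorphic`; theorems only. Sixth layer of the inline (D-0026) decomposition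
of `Literature.NumberTheory.Automorphic.strong_multiplicity_one_quaternionUnits` (Gelbart's
Thm. 10.5 (ii), proved in the source by the simple trace formula on the compact quotient of `D^×`).
The previous layers gave the kernel `K_Φ` of `R(Φ)` (`AutomorphicQuotientKernel*`), its diagonal
`K_Φ(x̃, x̃) = κ Σ_{γ ∈ G(K)} Φ_A(x̃ γ x̃⁻¹)`, `Φ_A = ∫_{A_G} Φ(a⁻¹ ·) dα`
(`AutomorphicQuotientKernelFibreSum`), and the abstract rearrangement of `Σ_{γ ∈ Γ}` by conjugacy
classes into orbital integrals (`MeasureTheory.Group.InvariantQuotientConjugacySum`). Here they are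
combined for an adelic group datum `𝒢` with a continuous central retraction `θ` and discrete
countable `G(K)`:

* `AdelicGroupData.exists_inv_mul_mem_centralizer_quotientSubgroup`,
  `AdelicGroupData.isOpen_subgroupOf_quotientSubgroup_of_center'_le`,
  `AdelicGroupData.center'_le_inf_centralizer` — the structural hypotheses of the abstract file
  hold for `L = A_G · G(K)`, `Γ = G(K)`: `L = Γ · C_L(Γ)` (`A_G` is central) and every subgroup of
  `L` containing `A_G` is relatively open (`A_G` is open in `L ≅ A_G × G(K)`);
* `AdelicGroupData.exists_lintegral_conjTsum_eq_tsum` — **the `[0, ∞]`-valued geometric side**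
  for `𝒢`: given, for each conjugacy class `c` of `G(K)` with representative `rep c`, a closed
  subgroup `G_c ⊇ L ∩ C(rep c)` centralising `rep c` with `G_c ⧸ (L ∩ C(rep c))` compact and
  invariant measures on `G(𝔸) ⧸ (L ∩ C(rep c))`, `G(𝔸) ⧸ G_c`, there are `d_c ∈ (0, ∞)` with
  `∫_X Σ_{γ ∈ G(K)} F(x γ x⁻¹) dμ = Σ'_c d_c ∫_{G(𝔸) ⧸ G_c} F(y (rep c) y⁻¹) dμ_c` for Borel `F ≥ 0`;
* `AdelicGroupData.quotientKernel_mk_mk_eq_smul_conjTsum` — the diagonal of the kernel is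
  `κ • conjTsum L G(K) Φ_A`;
* `AdelicGroupData.mul_tsum_lintegral_comp_conj_eq` and
  `AdelicGroupData.exists_conjTsum_enorm_le` — on a **compact** quotient,
  `Σ_{γ} ‖Φ_A(x̃ γ x̃⁻¹)‖ ≤ κ⁻¹ sup K_{|Φ|}` uniformly in `x̃`, so the integrability hypothesis
  of the abstract Bochner statement holds;
* `AdelicGroupData.integral_quotientKernel_diag_eq_mul_tsum` — **the geometric side**
  (Gelbart (9.13), Remark 9.23, (10.14)): for `Φ ∈ C_c(G(𝔸_K))`,
  `∫_X K_Φ(x, x) dμ(x) = κ Σ'_c d_c ∫_{G(𝔸) ⧸ G_c} Φ_A(y (rep c) y⁻¹) dμ_c(y)`,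
  the series converging absolutely and every orbital integrand being integrable.

CAVEAT (constants): `κ` is the constant of `ρ = κ • (α ⊗ counting)` and the `d_c` are only known
to lie in `(0, ∞)`; the identification of `κ d_c` with the Tamagawa-type volumes
`vol(Γ(γ) A \ G_γ)` of the printed formula is not made here.

## References

* S. Gelbart, *Automorphic forms on adele groups*, Ann. of Math. Studies 83 (1975), §9
  (9.11)–(9.13), Remark 9.23, (10.14) [Gelbart1975].
* D. Bump, *Automorphic Forms and Representations* (1997), §1.5 and Prop. 2.3.1 [Bump1997].
-/

noncomputable section

open MeasureTheory Measure Set Filter Topology CompactlySupported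
open Literature.MeasureTheory.Group
open scoped ENNReal NNReal Pointwise

namespace Literature.NumberTheory.Automorphic

-- the coset space carries the Borel σ-algebra supplied by the user, not the quotient σ-algebra
attribute [-instance] Quotient.instMeasurableSpace QuotientGroup.measurableSpace

/-- `g ∈ L ⊓ C_G(γ) ↔ g ∈ L ∧ g γ = γ g` (Mathlib `Subgroup.mem_centralizer_iff`). [folklore] -/
theorem mem_inf_centralizer_singleton_iff {G : Type*} [Group G] (L : Subgroup G) (γ g : G) :
    g ∈ L ⊓ Subgroup.centralizer {γ} ↔ g ∈ L ∧ g * γ = γ * g := by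
  rw [Subgroup.mem_inf, Subgroup.mem_centralizer_iff]
  simp only [Set.mem_singleton_iff, forall_eq]
  exact ⟨fun h => ⟨h.1, h.2.symm⟩, fun h => ⟨h.1, h.2.symm⟩⟩

namespace AdelicGroupData

universe u

variable {K : Type} [Field K] [NumberField K] (𝒢 : AdelicGroupData.{u} K)

attribute [local instance] measurableSpaceQuotientForm borelSpaceQuotientForm
  smulInvariantMeasureQuotientForm isFiniteMeasureOnCompactsQuotientForm isFiniteMeasureQuotientForm

/-! ### The structural hypotheses for `L = A_G · G(K)`, `Γ = G(K)` -/

/-- **`A_G · G(K) = G(K) · C(G(K))`**: every `ℓ ∈ A_G · G(K)` is `γ a` with `γ ∈ G(K)` and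
`a = γ⁻¹ ℓ ∈ A_G` central (`exists_inv_mul_mem_centralizer_of_le_center`). [folklore] -/
theorem exists_inv_mul_mem_centralizer_quotientSubgroup :
    ∀ ℓ ∈ 𝒢.quotientSubgroup, ∃ γ ∈ 𝒢.arithmeticSubgroup,
      γ⁻¹ * ℓ ∈ Subgroup.centralizer (𝒢.arithmeticSubgroup : Set 𝒢.Adelic) :=
  exists_inv_mul_mem_centralizer_of_le_center 𝒢.arithmeticSubgroup 𝒢.center' 𝒢.center'_le

/-- `G(K)` is stable under conjugation by `A_G · G(K)`. [folklore] -/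
theorem conj_mem_arithmeticSubgroup :
    ∀ ℓ ∈ 𝒢.quotientSubgroup, ∀ s ∈ (𝒢.arithmeticSubgroup : Set 𝒢.Adelic),
      ℓ * s * ℓ⁻¹ ∈ (𝒢.arithmeticSubgroup : Set 𝒢.Adelic) :=
  conj_mem_subgroup_of_exists _ _ (exists_inv_mul_mem_centralizer_quotientSubgroup 𝒢)

/-- `A_G ≤ L ∩ C_G(γ)` for every `γ` (`A_G` is central and contained in `L`). [folklore] -/
theorem center'_le_inf_centralizer (γ : 𝒢.Adelic) :
    𝒢.center' ≤ 𝒢.quotientSubgroup ⊓ Subgroup.centralizer {γ} := fun _ ha =>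
  (mem_inf_centralizer_singleton_iff _ _ _).2
    ⟨𝒢.center'_le_quotientSubgroup ha, (Subgroup.mem_center_iff.1 (𝒢.center'_le ha) γ).symm⟩

/-- **Subgroups of `L = A_G · G(K)` containing `A_G` are relatively open** when `G(K)` is discrete
and a continuous central retraction exists (`A_G` itself is, `isOpen_setOf_coe_mem_center'`).
[folklore] -/
theorem isOpen_subgroupOf_quotientSubgroup_of_center'_le (hdisc : 𝒢.IsDiscreteRational)
    (θ : 𝒢.Adelic →* 𝒢.Adelic) (hθc : Continuous θ) (hθA : ∀ g, θ g ∈ 𝒢.center')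
    (hθa : ∀ a ∈ 𝒢.center', θ a = a) (hθγ : ∀ γ ∈ 𝒢.arithmeticSubgroup, θ γ = 1)
    {M : Subgroup 𝒢.Adelic} (hM : 𝒢.center' ≤ M) :
    IsOpen ((M.subgroupOf 𝒢.quotientSubgroup : Subgroup 𝒢.quotientSubgroup) :
      Set 𝒢.quotientSubgroup) := by
  have h : IsOpen ((𝒢.center'.subgroupOf 𝒢.quotientSubgroup : Subgroup 𝒢.quotientSubgroup) :
      Set 𝒢.quotientSubgroup) :=
    isOpen_setOf_coe_mem_center' 𝒢 hdisc θ hθc hθA hθa hθγ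
  exact Subgroup.isOpen_mono (fun h hh => hM hh) h

/-! ### The `[0, ∞]`-valued geometric side for an adelic group datum -/

section Lintegral

variable [LocallyCompactSpace 𝒢.Adelic] [SecondCountableTopology 𝒢.Adelic] [T2Space 𝒢.Adelic]
  [MeasurableSpace 𝒢.Adelic] [BorelSpace 𝒢.Adelic] [Countable 𝒢.arithmeticSubgroup]
  (hdisc : 𝒢.IsDiscreteRational)
  (θ : 𝒢.Adelic →* 𝒢.Adelic) (hθc : Continuous θ) (hθA : ∀ g, θ g ∈ 𝒢.center')
  (hθa : ∀ a ∈ 𝒢.center', θ a = a) (hθγ : ∀ γ ∈ 𝒢.arithmeticSubgroup, θ γ = 1)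
  (rep : ConjClasses 𝒢.arithmeticSubgroup → 𝒢.arithmeticSubgroup)
  (hrep : ∀ c, ConjClasses.mk (rep c) = c)
  (Gc : ConjClasses 𝒢.arithmeticSubgroup → Subgroup 𝒢.Adelic)
  (hHG : ∀ c, 𝒢.quotientSubgroup ⊓ Subgroup.centralizer {(rep c : 𝒢.Adelic)} ≤ Gc c)
  (hGc : ∀ c, ∀ g ∈ Gc c, g * (rep c : 𝒢.Adelic) = (rep c : 𝒢.Adelic) * g)
  [hGcl : ∀ c, IsClosed ((Gc c : Subgroup 𝒢.Adelic) : Set 𝒢.Adelic)]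
  [∀ c, MeasurableSpace (𝒢.Adelic ⧸ (𝒢.quotientSubgroup ⊓
    Subgroup.centralizer {(rep c : 𝒢.Adelic)}))]
  [∀ c, BorelSpace (𝒢.Adelic ⧸ (𝒢.quotientSubgroup ⊓ Subgroup.centralizer {(rep c : 𝒢.Adelic)}))]
  [∀ c, MeasurableSpace (𝒢.Adelic ⧸ Gc c)] [∀ c, BorelSpace (𝒢.Adelic ⧸ Gc c)]
  (μ : Measure 𝒢.automorphicQuotient) [𝒢.IsAutomorphicMeasure μ]
  (μH : ∀ c, Measure (𝒢.Adelic ⧸ (𝒢.quotientSubgroup ⊓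
    Subgroup.centralizer {(rep c : 𝒢.Adelic)})))
  [∀ c, SMulInvariantMeasure 𝒢.Adelic _ (μH c)] [∀ c, IsFiniteMeasureOnCompacts (μH c)]
  (μC : ∀ c, Measure (𝒢.Adelic ⧸ Gc c))
  [∀ c, SMulInvariantMeasure 𝒢.Adelic _ (μC c)] [∀ c, IsFiniteMeasureOnCompacts (μC c)]

include hdisc hθc hθA hθa hθγ hrep hHG in
/-- **The `[0, ∞]`-valued geometric side for an adelic group datum** (Gelbart (1975), (9.13),
Remark 9.23). Let `𝒢` have `G(𝔸_K)` locally compact second countable Hausdorff, `G(K)` discrete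
and countable, and a continuous central retraction `θ` (so `L = A_G · G(K)` is closed and
`A_G` is open in it). For each conjugacy class `c` of `G(K)` fix a representative `rep c`, a
closed subgroup `G_c ⊇ L ∩ C(rep c)` centralising `rep c` with `G_c ⧸ (L ∩ C(rep c))` compact,
and non-zero `G(𝔸_K)`-invariant Borel measures finite on compact sets `μ_c^H` on
`G(𝔸_K) ⧸ (L ∩ C(rep c))` and `μ_c` on `G(𝔸_K) ⧸ G_c`; let `μ` be an automorphic measure. Then
there are `d_c ∈ (0, ∞)` with
`∫_X Σ'_{γ ∈ G(K)} F(x̃ γ x̃⁻¹) dμ(x) = Σ'_c d_c ∫_{G(𝔸_K) ⧸ G_c} F(y (rep c) y⁻¹) dμ_c(y)`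
for every Borel `F : G(𝔸_K) → [0, ∞]` (`MeasureTheory.Group.exists_lintegral_conjTsum_eq_tsum`).
CAVEAT: `d_c` is not identified with a volume here. [cite: Gelbart1975, (9.13) and Remark 9.23] -/
theorem exists_lintegral_conjTsum_eq_tsum
    [∀ c, CompactSpace (Gc c ⧸ (𝒢.quotientSubgroup ⊓
      Subgroup.centralizer {(rep c : 𝒢.Adelic)}).subgroupOf (Gc c))]
    (hμH : ∀ c, μH c ≠ 0) (hμC : ∀ c, μC c ≠ 0) :
    ∃ d : ConjClasses 𝒢.arithmeticSubgroup → ℝ≥0∞, (∀ c, d c ≠ 0 ∧ d c ≠ ∞) ∧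
      ∀ F : 𝒢.Adelic → ℝ≥0∞, Measurable F →
        ∫⁻ x, conjTsum 𝒢.quotientSubgroup (𝒢.arithmeticSubgroup : Set 𝒢.Adelic)
            (conj_mem_arithmeticSubgroup 𝒢) F x ∂μ =
          ∑' c, d c * ∫⁻ y, descConj (rep c : 𝒢.Adelic) (Gc c) (hGc c) F y ∂(μC c) := by
  haveI : IsClosed (𝒢.quotientSubgroup : Set 𝒢.Adelic) :=
    isClosed_quotientSubgroup_of_centralRetraction 𝒢 hdisc θ hθc hθA hθa hθγ
  exact Literature.MeasureTheory.Group.exists_lintegral_conjTsum_eq_tsum 𝒢.arithmeticSubgroup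
    𝒢.quotientSubgroup 𝒢.arithmeticSubgroup_le_quotientSubgroup
    (exists_inv_mul_mem_centralizer_quotientSubgroup 𝒢) rep hrep
    (fun c => 𝒢.quotientSubgroup ⊓ Subgroup.centralizer {(rep c : 𝒢.Adelic)}) Gc
    (fun c g => mem_inf_centralizer_singleton_iff _ _ _) hHG hGc μ μH μC
    (fun c => isOpen_subgroupOf_quotientSubgroup_of_center'_le 𝒢 hdisc θ hθc hθA hθa hθγ
      (center'_le_inf_centralizer 𝒢 _))
    (IsAutomorphicMeasure.ne_zero 𝒢 μ) hμH hμC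

end Lintegral

/-! ### The kernel on the diagonal and the bound on a compact quotient -/

section Kernel

variable [LocallyCompactSpace 𝒢.Adelic] [SecondCountableTopology 𝒢.Adelic] [T2Space 𝒢.Adelic]
  [MeasurableSpace 𝒢.Adelic] [BorelSpace 𝒢.Adelic] [Countable 𝒢.arithmeticSubgroup]
  [hH : IsClosed (𝒢.quotientSubgroup : Set 𝒢.Adelic)]
  (hdisc : 𝒢.IsDiscreteRational)
  (θ : 𝒢.Adelic →* 𝒢.Adelic) (hθc : Continuous θ) (hθA : ∀ g, θ g ∈ 𝒢.center')
  (hθa : ∀ a ∈ 𝒢.center', θ a = a) (hθγ : ∀ γ ∈ 𝒢.arithmeticSubgroup, θ γ = 1)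
  (α : Measure 𝒢.center') [α.IsHaarMeasure] [SFinite α]
  (ρ : Measure 𝒢.quotientSubgroup) [ρ.IsMulLeftInvariant] [SFinite ρ] {κ : ℝ≥0}
  (hκ : ρ = κ • Measure.map (fun p : 𝒢.center' × 𝒢.arithmeticSubgroup =>
      (⟨(p.1 : 𝒢.Adelic) * p.2, mulMap_mem 𝒢 p⟩ : 𝒢.quotientSubgroup)) (α.prod count))

include hdisc hθc hθA hθa hθγ hκ in
/-- **The kernel on the diagonal is `κ •` the sum over conjugates of `Φ_A`**:
`K_Φ(x̃H, x̃H) = κ • conjTsum L G(K) Φ_A (x̃H)` with `Φ_A(g) = ∫_{A_G} Φ(a⁻¹ g) dα(a)`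
(`quotientKernel_mk_mk_eq_smul_tsum_integral` restated). [cite: Gelbart1975, (9.12)] -/
theorem quotientKernel_mk_mk_eq_smul_conjTsum [ρ.IsMulRightInvariant] (Φ : C_c(𝒢.Adelic, ℂ))
    (x₀ : 𝒢.Adelic) :
    quotientKernel 𝒢.quotientSubgroup ρ Φ (QuotientGroup.mk x₀) (QuotientGroup.mk x₀) =
      κ • conjTsum 𝒢.quotientSubgroup (𝒢.arithmeticSubgroup : Set 𝒢.Adelic)
        (conj_mem_arithmeticSubgroup 𝒢) (fun g => ∫ a, Φ ((a : 𝒢.Adelic)⁻¹ * g) ∂α)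
        (QuotientGroup.mk x₀) := by
  rw [quotientKernel_mk_mk_eq_smul_tsum_integral 𝒢 hdisc θ hθc hθA hθa hθγ α ρ hκ Φ x₀,
    conjTsum_coe_mk]

include hθc hθA hθa hθγ hκ in
omit [LocallyCompactSpace 𝒢.Adelic] hH [α.IsHaarMeasure] [SFinite α] [ρ.IsMulLeftInvariant]
  [SFinite ρ] in
/-- **`∫_H F dρ = κ Σ_{γ ∈ G(K)} ∫_{A_G} F(a γ) dα(a)`** for Borel `F : H → [0, ∞]`
(`ρ = κ • ((a, γ) ↦ a γ)_* (α ⊗ counting)`, Tonelli). [folklore] -/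
theorem lintegral_quotientSubgroup_eq_mul_tsum_lintegral {F : 𝒢.quotientSubgroup → ℝ≥0∞}
    (hF : Measurable F) :
    ∫⁻ h, F h ∂ρ = κ * ∑' γ : 𝒢.arithmeticSubgroup,
      ∫⁻ a, F ⟨(a : 𝒢.Adelic) * γ, mulMap_mem 𝒢 (a, γ)⟩ ∂α := by
  have hme := measurableEmbedding_mulMap 𝒢 θ hθc hθA hθa hθγ
  have hFm : Measurable fun p : 𝒢.center' × 𝒢.arithmeticSubgroup =>
      F ⟨(p.1 : 𝒢.Adelic) * p.2, mulMap_mem 𝒢 p⟩ := hF.comp hme.measurable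
  rw [hκ, lintegral_smul_measure, hme.lintegral_map, lintegral_prod _ hFm.aemeasurable,
    ENNReal.smul_def, smul_eq_mul]
  congr 1
  have hterm : ∀ γ : 𝒢.arithmeticSubgroup, Measurable fun a : 𝒢.center' =>
      F ⟨(a : 𝒢.Adelic) * γ, mulMap_mem 𝒢 (a, γ)⟩ := fun γ =>
    hFm.comp (measurable_id.prodMk measurable_const)
  rw [← lintegral_tsum fun γ => (hterm γ).aemeasurable]
  refine lintegral_congr fun a => ?_
  rw [lintegral_count]

include hθc hθA hθa hθγ hκ in
omit [LocallyCompactSpace 𝒢.Adelic] hH [α.IsHaarMeasure] [SFinite α] [ρ.IsMulLeftInvariant]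
  [SFinite ρ] in
/-- **`κ Σ_{γ ∈ G(K)} ∫_{A_G} F(a⁻¹ x̃ γ x̃⁻¹) dα = ∫_H F(x̃ h⁻¹ x̃⁻¹) dρ(h)`** for Borel
`F : G(𝔸_K) → [0, ∞]` (`A_G` central, reindex `γ ↦ γ⁻¹`): with `F = ‖Φ‖`, the majorant of the
diagonal sum by the diagonal of the kernel of `|Φ|`. [cite: Gelbart1975, (9.12)] -/
theorem mul_tsum_lintegral_comp_conj_eq {F : 𝒢.Adelic → ℝ≥0∞} (hF : Measurable F)
    (x₀ : 𝒢.Adelic) :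
    (κ : ℝ≥0∞) * ∑' γ : 𝒢.arithmeticSubgroup,
        ∫⁻ a, F ((a : 𝒢.Adelic)⁻¹ * (x₀ * (γ : 𝒢.Adelic) * x₀⁻¹)) ∂α =
      ∫⁻ h : 𝒢.quotientSubgroup, F (x₀ * (h : 𝒢.Adelic)⁻¹ * x₀⁻¹) ∂ρ := by
  have hFm : Measurable fun h : 𝒢.quotientSubgroup => F (x₀ * (h : 𝒢.Adelic)⁻¹ * x₀⁻¹) :=
    hF.comp (by fun_prop : Measurable fun h : 𝒢.quotientSubgroup =>
      x₀ * (h : 𝒢.Adelic)⁻¹ * x₀⁻¹)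
  rw [lintegral_quotientSubgroup_eq_mul_tsum_lintegral 𝒢 θ hθc hθA hθa hθγ α ρ hκ hFm]
  congr 1
  -- reindex `γ ↦ γ⁻¹` and use that `A_G` is central
  rw [← (Equiv.inv 𝒢.arithmeticSubgroup).tsum_eq]
  refine tsum_congr fun γ => ?_
  refine lintegral_congr fun a => ?_
  have hac : ((a : 𝒢.Adelic))⁻¹ ∈ Subgroup.center 𝒢.Adelic :=
    Subgroup.inv_mem _ (𝒢.center'_le a.2)
  simp only [Equiv.inv_apply, InvMemClass.coe_inv, mul_inv_rev]
  have h1 : ((γ : 𝒢.Adelic))⁻¹ * ((a : 𝒢.Adelic))⁻¹ = ((a : 𝒢.Adelic))⁻¹ * ((γ : 𝒢.Adelic))⁻¹ :=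
    Subgroup.mem_center_iff.1 hac _
  have h2 : x₀ * ((a : 𝒢.Adelic))⁻¹ = ((a : 𝒢.Adelic))⁻¹ * x₀ := Subgroup.mem_center_iff.1 hac x₀
  congr 1
  calc ((a : 𝒢.Adelic))⁻¹ * (x₀ * ((γ : 𝒢.Adelic))⁻¹ * x₀⁻¹)
      = ((a : 𝒢.Adelic))⁻¹ * x₀ * ((γ : 𝒢.Adelic))⁻¹ * x₀⁻¹ := by simp only [mul_assoc]
    _ = x₀ * ((a : 𝒢.Adelic))⁻¹ * ((γ : 𝒢.Adelic))⁻¹ * x₀⁻¹ := by rw [h2]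
    _ = x₀ * (((a : 𝒢.Adelic))⁻¹ * ((γ : 𝒢.Adelic))⁻¹) * x₀⁻¹ := by simp only [mul_assoc]
    _ = x₀ * (((γ : 𝒢.Adelic))⁻¹ * ((a : 𝒢.Adelic))⁻¹) * x₀⁻¹ := by rw [h1]

include hθc hθA hθa hθγ hκ in
omit [α.IsHaarMeasure] [SFinite α] in
/-- **Uniform bound for the sum over conjugates on a compact quotient.** For
`Φ ∈ C_c(G(𝔸_K))`, `ρ ≠ 0` finite on compact sets and `X = G(𝔸_K) ⧸ (A_G · G(K))` compact, there
is `C < ∞` with `Σ'_{γ ∈ G(K)} ‖Φ_A(x̃ γ x̃⁻¹)‖ ≤ C` for all `x̃`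
(`Σ ‖Φ_A‖ ≤ κ⁻¹ K_{|Φ|}(x, x) ≤ κ⁻¹ sup K_{|Φ|}`, `exists_norm_quotientKernel_le'`). [folklore] -/
theorem exists_conjTsum_enorm_le [CompactSpace 𝒢.automorphicQuotient] [ρ.IsMulRightInvariant]
    [IsFiniteMeasureOnCompacts ρ] (hρ : ρ ≠ 0) (Φ : C_c(𝒢.Adelic, ℂ)) :
    ∃ C : ℝ≥0∞, C ≠ ∞ ∧ ∀ x,
      conjTsum 𝒢.quotientSubgroup (𝒢.arithmeticSubgroup : Set 𝒢.Adelic)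
        (conj_mem_arithmeticSubgroup 𝒢)
        (fun g => ‖∫ a, Φ ((a : 𝒢.Adelic)⁻¹ * g) ∂α‖ₑ) x ≤ C := by
  -- `κ ≠ 0` since `ρ ≠ 0`
  have hκ0 : κ ≠ 0 := by
    rintro rfl
    exact hρ (by rw [hκ, zero_smul])
  -- the kernel of `|Φ|` is bounded on the compact quotient
  set Ψ : C_c(𝒢.Adelic, ℂ) := ⟨⟨fun g => ((‖Φ g‖ : ℝ) : ℂ),
    Complex.continuous_ofReal.comp Φ.continuous.norm⟩,
    Φ.hasCompactSupport.norm.comp_left Complex.ofReal_zero⟩ with hΨ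
  obtain ⟨C, hC⟩ := exists_norm_quotientKernel_le' 𝒢 ρ Ψ
  refine ⟨(κ : ℝ≥0∞)⁻¹ * ENNReal.ofReal C,
    ENNReal.mul_ne_top (ENNReal.inv_ne_top.2 (ENNReal.coe_ne_zero.2 hκ0)) ENNReal.ofReal_ne_top,
    fun x => ?_⟩
  obtain ⟨x₀, rfl⟩ := QuotientGroup.mk_surjective x
  rw [conjTsum_coe_mk]
  -- `Σ ‖∫‖ ≤ Σ ∫ ‖·‖ = κ⁻¹ ∫_H ‖Φ(x̃ h⁻¹ x̃⁻¹)‖ dρ`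
  have h1 : ∑' γ : 𝒢.arithmeticSubgroup,
      ‖∫ a, Φ ((a : 𝒢.Adelic)⁻¹ * (x₀ * (γ : 𝒢.Adelic) * x₀⁻¹)) ∂α‖ₑ ≤
      (κ : ℝ≥0∞)⁻¹ * ∫⁻ h : 𝒢.quotientSubgroup, ‖Φ (x₀ * (h : 𝒢.Adelic)⁻¹ * x₀⁻¹)‖ₑ ∂ρ := by
    rw [← mul_tsum_lintegral_comp_conj_eq 𝒢 θ hθc hθA hθa hθγ α ρ hκ (F := fun g => ‖Φ g‖ₑ)
      Φ.continuous.measurable.enorm x₀, ← mul_assoc,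
      ENNReal.inv_mul_cancel (ENNReal.coe_ne_zero.2 hκ0) ENNReal.coe_ne_top, one_mul]
    exact ENNReal.tsum_le_tsum fun γ => enorm_integral_le_lintegral_enorm _
  refine h1.trans (mul_le_mul' le_rfl ?_)
  -- `∫_H ‖Φ(x̃ h⁻¹ x̃⁻¹)‖ dρ = K_{|Φ|}(x̃, x̃) ≤ C`
  have hfc : Continuous fun h : 𝒢.quotientSubgroup => Φ (x₀ * (h : 𝒢.Adelic)⁻¹ * x₀⁻¹) := by
    fun_prop
  have hfi : Integrable (fun h : 𝒢.quotientSubgroup => Φ (x₀ * (h : 𝒢.Adelic)⁻¹ * x₀⁻¹)) ρ :=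
    hfc.integrable_of_hasCompactSupport
      (hasCompactSupport_comp_conj 𝒢 hH Φ.hasCompactSupport x₀ x₀)
  rw [← ofReal_integral_norm_eq_lintegral_enorm hfi]
  refine ENNReal.ofReal_le_ofReal ?_
  have hK : quotientKernel 𝒢.quotientSubgroup ρ Ψ (QuotientGroup.mk x₀) (QuotientGroup.mk x₀) =
      ((∫ h : 𝒢.quotientSubgroup, ‖Φ (x₀ * (h : 𝒢.Adelic)⁻¹ * x₀⁻¹)‖ ∂ρ : ℝ) : ℂ) := by
    rw [quotientKernel_mk_mk, ← integral_complex_ofReal]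
    rfl
  have h2 := hC (QuotientGroup.mk x₀) (QuotientGroup.mk x₀)
  rw [hK, Complex.norm_real, Real.norm_of_nonneg (integral_nonneg fun h => norm_nonneg _)] at h2
  exact h2

end Kernel

/-! ### The geometric side -/

section Geometric

variable [LocallyCompactSpace 𝒢.Adelic] [SecondCountableTopology 𝒢.Adelic] [T2Space 𝒢.Adelic]
  [MeasurableSpace 𝒢.Adelic] [BorelSpace 𝒢.Adelic] [Countable 𝒢.arithmeticSubgroup]
  [hH : IsClosed (𝒢.quotientSubgroup : Set 𝒢.Adelic)]
  (hdisc : 𝒢.IsDiscreteRational)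
  (θ : 𝒢.Adelic →* 𝒢.Adelic) (hθc : Continuous θ) (hθA : ∀ g, θ g ∈ 𝒢.center')
  (hθa : ∀ a ∈ 𝒢.center', θ a = a) (hθγ : ∀ γ ∈ 𝒢.arithmeticSubgroup, θ γ = 1)
  (α : Measure 𝒢.center') [α.IsHaarMeasure] [SFinite α]
  (ρ : Measure 𝒢.quotientSubgroup) [ρ.IsMulLeftInvariant] [ρ.IsMulRightInvariant]
  [IsFiniteMeasureOnCompacts ρ] [SFinite ρ] {κ : ℝ≥0}
  (hκ : ρ = κ • Measure.map (fun p : 𝒢.center' × 𝒢.arithmeticSubgroup =>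
      (⟨(p.1 : 𝒢.Adelic) * p.2, mulMap_mem 𝒢 p⟩ : 𝒢.quotientSubgroup)) (α.prod count))
  (rep : ConjClasses 𝒢.arithmeticSubgroup → 𝒢.arithmeticSubgroup)
  (Gc : ConjClasses 𝒢.arithmeticSubgroup → Subgroup 𝒢.Adelic)
  (hGc : ∀ c, ∀ g ∈ Gc c, g * (rep c : 𝒢.Adelic) = (rep c : 𝒢.Adelic) * g)
  [∀ c, MeasurableSpace (𝒢.Adelic ⧸ Gc c)] [∀ c, BorelSpace (𝒢.Adelic ⧸ Gc c)]
  (μ : Measure 𝒢.automorphicQuotient) [𝒢.IsAutomorphicMeasure μ]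
  (μC : ∀ c, Measure (𝒢.Adelic ⧸ Gc c))

include hdisc hθc hθA hθa hθγ hκ in
/-- **The geometric side of the trace formula on a compact automorphic quotient** (Gelbart
(1975), (9.13): `tr R₀(φ) = Σ_{[γ]} vol(Γ(γ)\G_γ) ∫_{G_γ\G} φ(x⁻¹γx) dx`; Remark 9.23 and (10.14)
for the multiplicative group of a division quaternion algebra). Let `𝒢` be an adelic group datum
with `G(𝔸_K)` locally compact second countable Hausdorff, `G(K)` discrete countable, a
continuous central retraction `θ`, `X = G(𝔸_K) ⧸ (A_G · G(K))` **compact** with automorphic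
measure `μ`, `ρ = κ • (α ⊗ counting) ≠ 0` the Haar measure of `H = A_G · G(K)` (two-sided
invariant). Suppose representatives `rep c` of the conjugacy classes of `G(K)`, closed subgroups
`G_c` centralising `rep c`, invariant measures `μ_c` on `G(𝔸_K) ⧸ G_c` and constants `d_c ≠ 0`
satisfy the `[0, ∞]`-valued identity of `exists_lintegral_conjTsum_eq_tsum`. Then for every
`Φ ∈ C_c(G(𝔸_K))`, with `Φ_A(g) = ∫_{A_G} Φ(a⁻¹ g) dα(a)`: every orbital integrand
`y ↦ Φ_A(y (rep c) y⁻¹)` is `μ_c`-integrable, `Σ_c d_c ∫ |Φ_A(y (rep c) y⁻¹)| dμ_c < ∞`, and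

  `∫_X K_Φ(x, x) dμ(x) = κ Σ'_c d_c ∫_{G(𝔸_K) ⧸ G_c} Φ_A(y (rep c) y⁻¹) dμ_c(y)`.

With `hasSum_norm_sq_integratedOperator_rightRegular_eq_diagonal` (`Σ_i ‖R(f) e_i‖² =
c⁻¹ ∫_X K_{f ⋆ f^*}(x, x) dμ`) this is the simple trace formula for the Hilbert–Schmidt norm of
`R(f)` on the compact quotient. CAVEAT: `κ`, `c` and the `d_c` are not identified with the
volumes of the printed formula. [cite: Gelbart1975, (9.13), Remark 9.23 and (10.14)] -/
theorem integral_quotientKernel_diag_eq_mul_tsum [CompactSpace 𝒢.automorphicQuotient]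
    (hρ : ρ ≠ 0) {d : ConjClasses 𝒢.arithmeticSubgroup → ℝ≥0∞} (hd0 : ∀ c, d c ≠ 0)
    (hd : ∀ F : 𝒢.Adelic → ℝ≥0∞, Measurable F →
      ∫⁻ x, conjTsum 𝒢.quotientSubgroup (𝒢.arithmeticSubgroup : Set 𝒢.Adelic)
          (conj_mem_arithmeticSubgroup 𝒢) F x ∂μ =
        ∑' c, d c * ∫⁻ y, descConj (rep c : 𝒢.Adelic) (Gc c) (hGc c) F y ∂(μC c))
    (Φ : C_c(𝒢.Adelic, ℂ)) :
    (∀ c, Integrable (descConj (rep c : 𝒢.Adelic) (Gc c) (hGc c)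
      (fun g => ∫ a, Φ ((a : 𝒢.Adelic)⁻¹ * g) ∂α)) (μC c)) ∧
    Summable (fun c => (d c).toReal * ∫ y, ‖descConj (rep c : 𝒢.Adelic) (Gc c) (hGc c)
      (fun g => ∫ a, Φ ((a : 𝒢.Adelic)⁻¹ * g) ∂α) y‖ ∂(μC c)) ∧
    ∫ x, quotientKernel 𝒢.quotientSubgroup ρ Φ x x ∂μ =
      ((κ : ℝ) : ℂ) * ∑' c, ((d c).toReal : ℂ) * ∫ y, descConj (rep c : 𝒢.Adelic) (Gc c) (hGc c)
        (fun g => ∫ a, Φ ((a : 𝒢.Adelic)⁻¹ * g) ∂α) y ∂(μC c) := by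
  set ΦA : 𝒢.Adelic → ℂ := fun g => ∫ a, Φ ((a : 𝒢.Adelic)⁻¹ * g) ∂α with hΦA
  -- `Φ_A` is Borel
  have hΦAm : Measurable ΦA := by
    have hsm : StronglyMeasurable fun p : 𝒢.Adelic × 𝒢.center' =>
        Φ ((p.2 : 𝒢.Adelic)⁻¹ * p.1) :=
      (Φ.continuous.comp (by fun_prop)).stronglyMeasurable
    exact (hsm.integral_prod_right' (ν := α)).measurable
  -- the integrability hypothesis of the abstract statement
  obtain ⟨C, hCt, hC⟩ := exists_conjTsum_enorm_le 𝒢 θ hθc hθA hθa hθγ α ρ hκ hρ Φ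
  have hfin : ∫⁻ x, conjTsum 𝒢.quotientSubgroup (𝒢.arithmeticSubgroup : Set 𝒢.Adelic)
      (conj_mem_arithmeticSubgroup 𝒢) (fun g => ‖ΦA g‖ₑ) x ∂μ < ∞ := by
    calc ∫⁻ x, conjTsum 𝒢.quotientSubgroup (𝒢.arithmeticSubgroup : Set 𝒢.Adelic)
          (conj_mem_arithmeticSubgroup 𝒢) (fun g => ‖ΦA g‖ₑ) x ∂μ
        ≤ ∫⁻ _, C ∂μ := lintegral_mono fun x => hC x
      _ = C * μ Set.univ := lintegral_const C
      _ < ∞ := ENNReal.mul_lt_top hCt.lt_top (measure_lt_top μ _)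
  obtain ⟨-, hInt, hSum, hEq⟩ := integral_conjTsum_eq_tsum_of_lintegral_complex 𝒢.quotientSubgroup
    (𝒢.arithmeticSubgroup : Set 𝒢.Adelic) (conj_mem_arithmeticSubgroup 𝒢) μ
    (fun c => (rep c : 𝒢.Adelic)) Gc hGc μC hd0 hd hΦAm hfin
  refine ⟨hInt, hSum, ?_⟩
  have hK : ∀ x : 𝒢.automorphicQuotient, quotientKernel 𝒢.quotientSubgroup ρ Φ x x =
      ((κ : ℝ) : ℂ) * conjTsum 𝒢.quotientSubgroup (𝒢.arithmeticSubgroup : Set 𝒢.Adelic)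
        (conj_mem_arithmeticSubgroup 𝒢) ΦA x := by
    intro x
    obtain ⟨x₀, rfl⟩ := QuotientGroup.mk_surjective x
    rw [quotientKernel_mk_mk_eq_smul_conjTsum 𝒢 hdisc θ hθc hθA hθa hθγ α ρ hκ Φ x₀,
      NNReal.smul_def, Complex.real_smul]
  have hEq' : ∫ x : 𝒢.automorphicQuotient, conjTsum 𝒢.quotientSubgroup
      (𝒢.arithmeticSubgroup : Set 𝒢.Adelic) (conj_mem_arithmeticSubgroup 𝒢) ΦA x ∂μ =
      ∑' c, ((d c).toReal : ℂ) * ∫ y, descConj (rep c : 𝒢.Adelic) (Gc c) (hGc c) ΦA y ∂(μC c) :=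
    hEq
  rw [integral_congr_ae (Eventually.of_forall hK), integral_const_mul, hEq']

end Geometric

end AdelicGroupData

end Literature.NumberTheory.Automorphic
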